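import Summits.Ventures.PercRepro.RankLevelSetRuleQTenCert
import Summits.Ventures.PercRepro.RankLevelSetRuleQTenCore
import Summits.Ventures.PercRepro.RankLevelSetRuleQConvSeventeenBound

/-!
# PercRepro — THE FAMILY `k = 10` ON ITS WHOLE UNTRUNCATED REGIME, FOR EVERY `q` (p4, gen 25; C-044; paper
proofs/P4-CELL-THREE.md §13.5, §13.7)

**`rhat_ten_whole (q m : ℕ) (hm : m + 9 ≤ q) : phiK (q + 10) q ≤ rhat q 10 m`** — Rule Q's equal split pays `Φ(q+10, q)` to
EVERY member of EVERY cell `(q+10, q)` with `#P ≤ q − 9` (the whole untruncated regime `u = q − #P ≥ k − 1`), uniformly in `q`.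
The same proof as RankLevelSetRuleQFiveWhole (paper §13): `(R̂ − Φ)·den = na·S(q,m) + nb` (**`rhat_ten_key`**) with the master
sum `S` of RankLevelSetRuleQSumS, the two-sided continued-fraction bounds `C_15 ≤ S ≤ C_17` (`C_15` resp. `C_17` from the
tree or proved as a sub- or super-solution of the recurrence), and the two certificates `na·C_15 + nb ≥ 0`,
`na·C_17 + nb ≥ 0` (polynomials with non-negative coefficients in `(q−m−9, m)`).  No `sorry`; axioms standard.
-/

namespace PercRepro

open Finset

/-- The lower certificate is non-negative for `a, b ≥ 0`. -/
lemma ten_lower_cert_nonneg (a b : ℚ) (ha : 0 ≤ a) (hb : 0 ≤ b) :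
    0 ≤ naTen (a + b + 9) b * cfFifteenN (a + b + 9) b + nbTen (a + b + 9) b * cfFifteenD (a + b + 9) b := by
  rw [ten_lower_cert]; exact (add_nonneg (add_nonneg (add_nonneg (tenLowerCert1_nonneg a b ha hb) (tenLowerCert2_nonneg a b ha hb)) (tenLowerCert3_nonneg a b ha hb)) (tenLowerCert4_nonneg a b ha hb))

/-- The upper certificate is non-negative for `a, b ≥ 0`. -/
lemma ten_upper_cert_nonneg (a b : ℚ) (ha : 0 ≤ a) (hb : 0 ≤ b) :
    0 ≤ naTen (a + b + 9) b * cfSeventeenN (a + b + 9) b + nbTen (a + b + 9) b * cfSeventeenD (a + b + 9) b := by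
  rw [ten_upper_cert]; exact (add_nonneg (add_nonneg (add_nonneg (tenUpperCert1_nonneg a b ha hb) (tenUpperCert2_nonneg a b ha hb)) (tenUpperCert3_nonneg a b ha hb)) (tenUpperCert4_nonneg a b ha hb))

/-- `na·C_15 + nb ≥ 0` on the untruncated regime. -/
lemma ten_lower_nonneg (q m : ℕ) (hm : m + 9 ≤ q) :
    0 ≤ naTen q m * (cfFifteenN q m / cfFifteenD q m) + nbTen q m := by
  have hD := cfFifteenD_pos q m (by positivity) (by exact_mod_cast (show m + 1 ≤ q by omega))
  have ha : (0 : ℚ) ≤ (q : ℚ) - m - 9 := by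
    have : ((m + 9 : ℕ) : ℚ) ≤ q := by exact_mod_cast hm
    push_cast at this; linarith
  have key := ten_lower_cert_nonneg ((q : ℚ) - m - 9) m ha (by positivity)
  rw [show (q : ℚ) - m - 9 + m + 9 = q by ring] at key
  have e : naTen q m * (cfFifteenN q m / cfFifteenD q m) + nbTen q m
      = (naTen q m * cfFifteenN q m + nbTen q m * cfFifteenD q m) / cfFifteenD q m := by
    rw [eq_div_iff hD.ne']; ring_nf; field_simp
  rw [e]
  exact div_nonneg key hD.le

/-- `na·C_17 + nb ≥ 0` on the untruncated regime. -/
lemma ten_upper_nonneg (q m : ℕ) (hm : m + 9 ≤ q) :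
    0 ≤ naTen q m * (cfSeventeenN q m / cfSeventeenD q m) + nbTen q m := by
  have hD := cfSeventeenD_pos q m (by positivity) (by exact_mod_cast (show m + 1 ≤ q by omega))
  have ha : (0 : ℚ) ≤ (q : ℚ) - m - 9 := by
    have : ((m + 9 : ℕ) : ℚ) ≤ q := by exact_mod_cast hm
    push_cast at this; linarith
  have key := ten_upper_cert_nonneg ((q : ℚ) - m - 9) m ha (by positivity)
  rw [show (q : ℚ) - m - 9 + m + 9 = q by ring] at key
  have e : naTen q m * (cfSeventeenN q m / cfSeventeenD q m) + nbTen q m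
      = (naTen q m * cfSeventeenN q m + nbTen q m * cfSeventeenD q m) / cfSeventeenD q m := by
    rw [eq_div_iff hD.ne']; ring_nf; field_simp
  rw [e]
  exact div_nonneg key hD.le

/-- **THE FAMILY `k = 10` ON ITS WHOLE UNTRUNCATED REGIME, FOR EVERY `q`**: `Φ(q+10, q) ≤ R̂(q, 10, m)` for every `m ≤ q − 9`. -/
theorem rhat_ten_whole (q m : ℕ) (hm : m + 9 ≤ q) : phiK (q + 10) q ≤ rhat q 10 m := by
  have hkey := rhat_ten_key q m hm
  have hden := denTen_pos q m
  have hlo := cfFifteen_le_sumS q m (by omega)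
  have hhi := sumS_le_cfSeventeen q m (by omega)
  have hL := ten_lower_nonneg q m hm
  have hU := ten_upper_nonneg q m hm
  have hmain : 0 ≤ naTen q m * sumS q m + nbTen q m := by
    rcases le_total 0 (naTen q m) with hA | hA
    · calc (0 : ℚ) ≤ naTen q m * (cfFifteenN q m / cfFifteenD q m) + nbTen q m := hL
        _ ≤ naTen q m * sumS q m + nbTen q m := by
          gcongr
    · calc (0 : ℚ) ≤ naTen q m * (cfSeventeenN q m / cfSeventeenD q m) + nbTen q m := hU
        _ ≤ naTen q m * sumS q m + nbTen q m := by
          have := mul_le_mul_of_nonpos_left hhi hA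
          linarith
  rw [← sub_nonneg]
  rw [← hkey] at hmain
  exact nonneg_of_mul_nonneg_left hmain hden

/-- The matroid form: Rule Q's equal split pays `Φ(q+10,q)` to every member of every cell `(q+10, q)` with `#P ≤ q − 9`
(the whole untruncated regime of the family `k = 10`), for every `q`. -/
theorem ruleQRecv_ge_ten_whole (q m : ℕ) (hm : m + 9 ≤ q) : phiK (q + 10) q ≤ rhat q 10 m :=
  rhat_ten_whole q m hm

end PercRepro
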